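import Literature.Probability.Entropy.PinskerInequality
import Summits.Ventures.LatticeQCDFlow.Scaling.Acceptance
import Summits.Ventures.LatticeQCDFlow.Scaling.AcceptancePinskerFloor
import Summits.Ventures.LatticeQCDFlow.Scaling.AcceptanceTransfer
import HarnessLib

/-!
# LatticeQCDFlow / Scaling — the stationary acceptance is 2-Lipschitz in the model law (and in the target), and 2 is sharp

HONEST FRAMING: exact (Metropolis-corrected) sampling algorithms for lattice gauge theory;
figures of merit are autocorrelation/cost numbers at stated couplings and volumes; no
continuum-physics claim.

Venture `LatticeQCDFlow` (cell pub-lqcd), topic `Scaling`; FANOUT row 4 (`s0-u1-b`, rung S0-B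
implementation B: an independent code path for the 2D U(1) flow, compared with implementation A by
the test 'acceptance A vs B within 3 pp at every β').  NEW WORK of the cell — a short corollary
over the tree's `Scaling/Acceptance.lean` (`accRate_eq_one_sub_tvDist_prodLaw`: the stationary
independence-Metropolis acceptance is `1 − ‖p ⊗ q − q ⊗ p‖_TV`; `tvDist_prodLaw_left/right`);
the one cited fact used is Pinsker's inequality with the sharp constant, already in the tree as
`Literature.Probability.Entropy.two_mul_tvDist_sq_le_kl` [cite: PolyanskiyWu2024, Thm 7.10].
Finite state space `X`; `p` the target, `q`, `q'` two model laws (probability vectors);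
`accRate p q = Σ_x Σ_y min (p x · q y) (p y · q x)` (`Exactness/FlowMCMC.lean`), `tvDist` the
total-variation distance (`Literature/Probability/MarkovChains/TotalVariation.lean`), `klFin`
the finite relative entropy (`Scaling/ImportanceWeights.lean`).

WHAT IS PROVED (all `[folklore]`-level, elementary):

* `abs_tvDist_sub_tvDist_le` — `|TV(a, b) − TV(a', b')| ≤ TV(a, a') + TV(b, b')`;
* **`abs_accRate_sub_accRate_le_two_mul_tvDist`** — at a fixed target `p`, two models `q`, `q'`
  have stationary acceptances within `2·‖q − q'‖_TV` (no sign hypothesis on `q`, `q'`);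
* `abs_accRate_sub_accRate_le_two_mul_tvDist_target` — the same in the target at a fixed model;
  `abs_accRate_sub_accRate_le` — jointly `≤ 2 (‖p − p'‖_TV + ‖q − q'‖_TV)`;
* **`half_abs_accRate_sub_le_tvDist`**, `sq_accRate_sub_le_two_mul_klFin` — the CERTIFICATE
  reading: an acceptance gap `Δ` between two models at one target forces `‖q − q'‖_TV ≥ Δ/2` and
  (Pinsker) `D_KL(q‖q') ≥ Δ²/2`, `D_KL(q'‖q) ≥ Δ²/2`;
* **`abs_accRate_sub_le_exp_sub_one`** — the PARITY reading: if two codes' model densities agree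
  to `δ` in log uniformly (`|log q x − log q' x| ≤ δ`), their stationary acceptances agree to
  `e^δ − 1` (via `two_mul_tvDist_le_exp_sub_one`);
* **`exists_accRate_gap_gt`** — the constant `2` is SHARP: for every `c < 2` a three-point target
  and two models with `|acc(p, q) − acc(p, q')| > c·‖q − q'‖_TV` (`p = q = (η, η, 1 − 2η)`,
  `q' = (η − ε, η + ε, 1 − 2η)`: gap `2(1 − η)ε` against `TV = ε`; `accRate_threePoint`,
  `tvDist_threePoint`, `accRate_self_eq_one`).  No definition is introduced.

BUILD-HYGIENE NOTE (ops-buildfix, 2026-08-22; statements of every remaining theorem unchanged):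
`Scaling/AcceptanceTransfer.lean` landed in the same minutes and declares, in this same namespace,
`abs_tvDist_sub_tvDist_le` (same statement), `abs_accRate_sub_accRate_le_two_mul_tvDist_right`
(= the model-slot law above, identical statement), `abs_accRate_sub_accRate_le_two_mul_tvDist`
(its TARGET-slot law) and `abs_accRate_sub_accRate_le` (the joint form with `2a + 2b`), so the two
modules could not be imported together («environment already contains …»).  This file now IMPORTS
`Scaling/AcceptanceTransfer` and reuses those two laws instead of re-proving them (the first two
bullets above are served by `abs_tvDist_sub_tvDist_le` / `abs_accRate_sub_accRate_le_two_mul_tvDist_right`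
of that module), and its own joint form is `ModelLipschitz.abs_accRate_sub_accRate_le`.

WHY (row 4's acceptance clause, value-free).  The clause compares the stationary acceptances of
two implementations.  With the SAME trained weights the two codes realise one model law up to
their numerical parity `δ`, so the clause can only fail by `e^δ − 1` plus Monte-Carlo error — the
same-weights column tests the code path; with each arm's OWN trained weights the clause compares
two different models `q_A`, `q_B` at one target, and a gap of `Δ` there is a certificate that the
two trained models differ by at least `Δ/2` in total variation (and `Δ²/2` nat in either KL),
whatever the codes — the own-stop column tests the training, not the implementation.  Nothing here
bounds `τ_int`; acceptance agreement does NOT imply model agreement (`Scaling/Acceptance.lean`,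
`acceptance_blind`).  No number of ours and no sealed value is referenced.
-/

namespace Summit.Ventures.LatticeQCDFlow.Theory2

open Finset
open Literature.Probability.MarkovChains
open Summit.Ventures.LatticeQCDFlow.Exactness

variable {X : Type*} [Fintype X]

section Lipschitz

-- `abs_tvDist_sub_tvDist_le` (`|TV(a, b) − TV(a', b')| ≤ TV(a, a') + TV(b, b')`) and the model-slot
-- law `|acc(p, q) − acc(p, q')| ≤ 2·‖q − q'‖_TV` (here: `abs_accRate_sub_accRate_le_two_mul_tvDist_right`)
-- were re-proved in this file when it landed (p324541); the byte-identical statements landed in the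
-- same minutes in `Scaling/AcceptanceTransfer.lean` (p324626) in this same namespace, which made the
-- two modules impossible to import together.  Build-hygiene repair (ops-buildfix, 2026-08-22): the
-- two local copies are dropped and the imported theorems are used below; nothing else changes.

/-- **… and 2-Lipschitz in the target law** at a fixed model `q` (a probability vector):
`|acc(p, q) − acc(p', q)| ≤ 2·‖p − p'‖_TV` (by the symmetry `accRate_comm`). [folklore] -/
theorem abs_accRate_sub_accRate_le_two_mul_tvDist_target {p p' q : X → ℝ} (hq : ∀ x, 0 ≤ q x)
    (hq1 : ∑ x, q x = 1) (hp1 : ∑ x, p x = 1) (hp1' : ∑ x, p' x = 1) :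
    |accRate p q - accRate p' q| ≤ 2 * tvDist p p' := by
  rw [accRate_comm p q, accRate_comm p' q]
  exact abs_accRate_sub_accRate_le_two_mul_tvDist_right hq hq1 hp1 hp1'

-- The joint form lives in the sub-namespace `ModelLipschitz`: `Scaling/AcceptanceTransfer.lean`
-- owns `Theory2.abs_accRate_sub_accRate_le` (the same law in the shape `2a + 2b`).
namespace ModelLipschitz

/-- Joint form: `|acc(p, q) − acc(p', q')| ≤ 2 (‖p − p'‖_TV + ‖q − q'‖_TV)` for probability
vectors `p`, `q'` and unit-mass `p'`, `q`. [folklore] -/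
theorem abs_accRate_sub_accRate_le {p p' q q' : X → ℝ} (hp : ∀ x, 0 ≤ p x) (hp1 : ∑ x, p x = 1)
    (hp1' : ∑ x, p' x = 1) (hq1 : ∑ x, q x = 1) (hq' : ∀ x, 0 ≤ q' x) (hq1' : ∑ x, q' x = 1) :
    |accRate p q - accRate p' q'| ≤ 2 * (tvDist p p' + tvDist q q') := by
  have h1 := abs_accRate_sub_accRate_le_two_mul_tvDist_right hp hp1 hq1 hq1'
  have h2 := abs_accRate_sub_accRate_le_two_mul_tvDist_target hq' hq1' hp1 hp1'
  calc |accRate p q - accRate p' q'|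
      = |(accRate p q - accRate p q') + (accRate p q' - accRate p' q')| := by ring_nf
    _ ≤ |accRate p q - accRate p q'| + |accRate p q' - accRate p' q'| := abs_add_le _ _
    _ ≤ 2 * (tvDist p p' + tvDist q q') := by linarith

end ModelLipschitz

/-- **Certificate reading.**  An acceptance gap `Δ = |acc(p, q) − acc(p, q')|` between two models
at one target certifies `‖q − q'‖_TV ≥ Δ/2`. [folklore] -/
theorem half_abs_accRate_sub_le_tvDist {p q q' : X → ℝ} (hp : ∀ x, 0 ≤ p x)
    (hp1 : ∑ x, p x = 1) (hq1 : ∑ x, q x = 1) (hq1' : ∑ x, q' x = 1) :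
    |accRate p q - accRate p q'| / 2 ≤ tvDist q q' := by
  have h := abs_accRate_sub_accRate_le_two_mul_tvDist_right hp hp1 hq1 hq1'
  linarith

/-- **Certificate reading through Pinsker.**  For positive models, the acceptance gap at one target
floors the relative entropy between them: `Δ²/2 ≤ D_KL(q‖q')` (and, swapping the roles,
`Δ²/2 ≤ D_KL(q'‖q)`), from `Δ/2 ≤ TV` and `2·TV² ≤ D_KL` [cite: PolyanskiyWu2024, Thm 7.10]. -/
theorem sq_accRate_sub_le_two_mul_klFin {p q q' : X → ℝ} (hp : ∀ x, 0 ≤ p x)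
    (hp1 : ∑ x, p x = 1) (hq : ∀ x, 0 < q x) (hq' : ∀ x, 0 < q' x) (hq1 : ∑ x, q x = 1)
    (hq1' : ∑ x, q' x = 1) :
    (accRate p q - accRate p q') ^ 2 ≤ 2 * klFin q q' := by
  classical
  have h := half_abs_accRate_sub_le_tvDist hp hp1 hq1 hq1'
  have hpin : 2 * tvDist q q' ^ 2 ≤ klFin q q' :=
    Literature.Probability.Entropy.two_mul_tvDist_sq_le_kl hq hq' hq1 hq1'
  have h0 : 0 ≤ |accRate p q - accRate p q'| / 2 := by positivity
  have h2 : (|accRate p q - accRate p q'| / 2) ^ 2 ≤ tvDist q q' ^ 2 := pow_le_pow_left₀ h0 h 2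
  have h3 : (accRate p q - accRate p q') ^ 2 = 4 * (|accRate p q - accRate p q'| / 2) ^ 2 := by
    rw [div_pow, sq_abs]; ring
  rw [h3]
  linarith

end Lipschitz

section Parity

/-- Uniform log-density parity controls total variation: if `q`, `q'` are positive, `q` has unit
mass and `|log q x − log q' x| ≤ δ` for every `x`, then `2·‖q − q'‖_TV ≤ e^δ − 1`. [folklore] -/
theorem two_mul_tvDist_le_exp_sub_one {q q' : X → ℝ} (hq : ∀ x, 0 < q x) (hq' : ∀ x, 0 < q' x)
    (hq1 : ∑ x, q x = 1) {δ : ℝ} (hlog : ∀ x, |Real.log (q x) - Real.log (q' x)| ≤ δ) :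
    2 * tvDist q q' ≤ Real.exp δ - 1 := by
  have key : ∀ x, |q x - q' x| ≤ (Real.exp δ - 1) * q x := by
    intro x
    have h := hlog x
    rw [abs_sub_le_iff] at h
    -- `q' x ≤ e^δ · q x` and `q x ≤ e^δ · q' x`
    have h1 : q' x ≤ Real.exp δ * q x := by
      have : Real.log (q' x) ≤ δ + Real.log (q x) := by linarith [h.2]
      calc q' x = Real.exp (Real.log (q' x)) := (Real.exp_log (hq' x)).symm
        _ ≤ Real.exp (δ + Real.log (q x)) := Real.exp_le_exp.2 this
        _ = Real.exp δ * q x := by rw [Real.exp_add, Real.exp_log (hq x)]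
    have h2 : q x ≤ Real.exp δ * q' x := by
      have : Real.log (q x) ≤ δ + Real.log (q' x) := by linarith [h.1]
      calc q x = Real.exp (Real.log (q x)) := (Real.exp_log (hq x)).symm
        _ ≤ Real.exp (δ + Real.log (q' x)) := Real.exp_le_exp.2 this
        _ = Real.exp δ * q' x := by rw [Real.exp_add, Real.exp_log (hq' x)]
    rw [abs_le]
    constructor
    · -- `-( (e^δ − 1) q ) ≤ q − q'`, i.e. `q' ≤ e^δ q`
      nlinarith [h1]
    · -- `q − q' ≤ (e^δ − 1) q`: from `q ≤ e^δ q'` and `q' ≤ q ∨ q ≤ q'`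
      rcases le_total (q' x) (q x) with hle | hle
      · have hδ : 1 ≤ Real.exp δ := by
          have : q x ≤ Real.exp δ * q x := le_trans h2 (by nlinarith [hq' x, Real.exp_pos δ])
          nlinarith [hq x]
        nlinarith [hq' x]
      · nlinarith [Real.add_one_le_exp δ, hq x, Real.exp_pos δ]
  unfold tvDist
  calc 2 * (1 / 2 * ∑ x, |q x - q' x|) = ∑ x, |q x - q' x| := by ring
    _ ≤ ∑ x, (Real.exp δ - 1) * q x := sum_le_sum fun x _ => key x
    _ = Real.exp δ - 1 := by rw [← mul_sum, hq1, mul_one]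

/-- **Parity reading.**  Two codes realising positive model laws `q`, `q'` that agree to `δ` in
log uniformly (`|log q x − log q' x| ≤ δ`) have stationary acceptances, at any common target `p`,
within `e^δ − 1` of each other. [folklore] -/
theorem abs_accRate_sub_le_exp_sub_one {p q q' : X → ℝ} (hp : ∀ x, 0 ≤ p x) (hp1 : ∑ x, p x = 1)
    (hq : ∀ x, 0 < q x) (hq' : ∀ x, 0 < q' x) (hq1 : ∑ x, q x = 1) (hq1' : ∑ x, q' x = 1)
    {δ : ℝ} (hlog : ∀ x, |Real.log (q x) - Real.log (q' x)| ≤ δ) :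
    |accRate p q - accRate p q'| ≤ Real.exp δ - 1 :=
  (abs_accRate_sub_accRate_le_two_mul_tvDist_right hp hp1 hq1 hq1').trans
    (two_mul_tvDist_le_exp_sub_one hq hq' hq1 hlog)

end Parity

section Sharp

/-- `(η, η, 1 − 2η)` has unit mass. -/
theorem sum_threePoint (η : ℝ) : ∑ i, (![η, η, 1 - 2 * η] : Fin 3 → ℝ) i = 1 := by
  rw [Fin.sum_univ_three]
  simp only [Matrix.cons_val_zero, Matrix.cons_val_one, Matrix.head_cons, Matrix.cons_val_two,
    Matrix.tail_cons]
  ring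

/-- `(η − ε, η + ε, 1 − 2η)` has unit mass. -/
theorem sum_threePointShift (η ε : ℝ) :
    ∑ i, (![η - ε, η + ε, 1 - 2 * η] : Fin 3 → ℝ) i = 1 := by
  rw [Fin.sum_univ_three]
  simp only [Matrix.cons_val_zero, Matrix.cons_val_one, Matrix.head_cons, Matrix.cons_val_two,
    Matrix.tail_cons]
  ring

/-- `‖(η, η, 1−2η) − (η−ε, η+ε, 1−2η)‖_TV = ε` for `0 ≤ ε`. -/
theorem tvDist_threePoint {η ε : ℝ} (hε : 0 ≤ ε) :
    tvDist (![η, η, 1 - 2 * η] : Fin 3 → ℝ) ![η - ε, η + ε, 1 - 2 * η] = ε := by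
  unfold tvDist
  rw [Fin.sum_univ_three]
  simp only [Matrix.cons_val_zero, Matrix.cons_val_one, Matrix.head_cons, Matrix.cons_val_two,
    Matrix.tail_cons]
  have h1 : |η - (η - ε)| = ε := by rw [sub_sub_cancel, abs_of_nonneg hε]
  have h2 : |η - (η + ε)| = ε := by
    rw [show η - (η + ε) = -ε by ring, abs_neg, abs_of_nonneg hε]
  rw [h1, h2, sub_self, abs_zero]
  ring

/-- A model equal to its (unit-mass) target is accepted surely: `acc(p, p) = (Σ p)² = 1`. -/
theorem accRate_self_eq_one {p : X → ℝ} (hp1 : ∑ x, p x = 1) : accRate p p = 1 := by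
  have h : ∀ x y : X, min (p x * p y) (p y * p x) = p x * p y := fun x y => by
    rw [mul_comm (p y), min_self]
  unfold accRate
  simp_rw [h, ← mul_sum, hp1, mul_one, hp1]

/-- The perturbed model's stationary acceptance at the target `(η, η, 1 − 2η)`:
`acc((η, η, 1−2η), (η−ε, η+ε, 1−2η)) = 1 − 2(1 − η)ε` for `0 ≤ ε ≤ η`, `2η ≤ 1`. -/
theorem accRate_threePoint {η ε : ℝ} (hε : 0 ≤ ε) (hεη : ε ≤ η) (hη : 2 * η ≤ 1) :
    accRate (![η, η, 1 - 2 * η] : Fin 3 → ℝ) ![η - ε, η + ε, 1 - 2 * η] =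
      1 - 2 * (1 - η) * ε := by
  have hη0 : 0 ≤ η := hε.trans hεη
  have hρ : 0 ≤ 1 - 2 * η := by linarith
  unfold accRate
  simp only [Fin.sum_univ_three, Matrix.cons_val_zero, Matrix.cons_val_one, Matrix.head_cons,
    Matrix.cons_val_two, Matrix.tail_cons, min_self]
  -- the six off-diagonal minima
  have m01 : min (η * (η + ε)) (η * (η - ε)) = η * (η - ε) := min_eq_right (by nlinarith)
  have m10 : min (η * (η - ε)) (η * (η + ε)) = η * (η - ε) := min_eq_left (by nlinarith)
  have m02 : min (η * (1 - 2 * η)) ((1 - 2 * η) * (η - ε)) = (1 - 2 * η) * (η - ε) :=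
    min_eq_right (by nlinarith)
  have m20 : min ((1 - 2 * η) * (η - ε)) (η * (1 - 2 * η)) = (1 - 2 * η) * (η - ε) :=
    min_eq_left (by nlinarith)
  have m12 : min (η * (1 - 2 * η)) ((1 - 2 * η) * (η + ε)) = η * (1 - 2 * η) :=
    min_eq_left (by nlinarith)
  have m21 : min ((1 - 2 * η) * (η + ε)) (η * (1 - 2 * η)) = η * (1 - 2 * η) :=
    min_eq_right (by nlinarith)
  rw [m01, m10, m02, m20, m12, m21]
  ring

/-- **The Lipschitz constant 2 is sharp.**  For every `c < 2` there are a three-point target `p`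
and positive models `q`, `q'` (probability vectors) with `c·‖q − q'‖_TV < |acc(p, q) − acc(p, q')|`
— the witness is `p = q = (η, η, 1 − 2η)`, `q' = (η − ε, η + ε, 1 − 2η)` with gap `2(1 − η)ε`
against `TV = ε` (`η ≤ 1/4`, `η ≤ (2 − c)/4`, `ε = η/2`). [folklore] -/
theorem exists_accRate_gap_gt {c : ℝ} (hc : c < 2) :
    ∃ p q q' : Fin 3 → ℝ, (∀ i, 0 < p i) ∧ (∀ i, 0 < q i) ∧ (∀ i, 0 < q' i) ∧
      ∑ i, p i = 1 ∧ ∑ i, q i = 1 ∧ ∑ i, q' i = 1 ∧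
      c * tvDist q q' < |accRate p q - accRate p q'| := by
  -- choose `η ∈ (0, 1/4]` with `2(1 − η) > c`, then `ε = η/2`
  set η : ℝ := min (1 / 4) ((2 - c) / 4) with hηdef
  have hη0 : 0 < η := lt_min (by norm_num) (by linarith)
  have hη4 : η ≤ 1 / 4 := min_le_left _ _
  have hηc : η ≤ (2 - c) / 4 := min_le_right _ _
  set ε : ℝ := η / 2 with hεdef
  have hε0 : 0 < ε := by positivity
  have hεη : ε ≤ η := by linarith
  have hη : 2 * η ≤ 1 := by linarith
  have hpos : ∀ i, 0 < (![η, η, 1 - 2 * η] : Fin 3 → ℝ) i := by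
    intro i
    fin_cases i
    · exact hη0
    · exact hη0
    · show 0 < 1 - 2 * η
      linarith
  have hpos' : ∀ i, 0 < (![η - ε, η + ε, 1 - 2 * η] : Fin 3 → ℝ) i := by
    intro i
    fin_cases i
    · show 0 < η - ε
      linarith
    · show 0 < η + ε
      linarith
    · show 0 < 1 - 2 * η
      linarith
  refine ⟨![η, η, 1 - 2 * η], ![η, η, 1 - 2 * η], ![η - ε, η + ε, 1 - 2 * η], hpos, hpos,
    hpos', sum_threePoint η, sum_threePoint η, sum_threePointShift η ε, ?_⟩
  rw [tvDist_threePoint hε0.le, accRate_self_eq_one (sum_threePoint η),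
    accRate_threePoint hε0.le hεη hη,
    show (1 : ℝ) - (1 - 2 * (1 - η) * ε) = 2 * (1 - η) * ε by ring, abs_of_pos (by nlinarith)]
  nlinarith

end Sharp

end Summit.Ventures.LatticeQCDFlow.Theory2
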